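import Summits.BirchSwinnertonDyer.BirchSwinnertonDyer.Theorems.KolyvaginDepthDoorDepthTableIntrinsic
import Literature.NumberTheory.EllipticCurves.SkinnerUrban2014.SemistableCurvesProofs
import Literature.NumberTheory.EllipticCurves.BSDSelmerPConverseSerreProofs
import Literature.NumberTheory.EllipticCurves.Rank1Residual.Dedup
import HarnessLib

/-!
# Route `KolyvaginDepthDoor`, crux `KolyvaginDepthSupplyKN` (stmt-BirchSwinnertonDyer-22820) —
# DEPTH TABLE v16, GENERIC: on a SEMISTABLE curve the tower-surjectivity hypothesis of the intrinsic row is PRINT at every `p ≥ 11`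
# (Mazur 1978 Thm. 4 + Serre 1972 Prop. 21 + Serre's lifting lemma, granted Mazur's torsion theorem BY NAME)

Helper file of the lead prover of line `levelone` (kdd-p1 g20; `--supports stmt-BirchSwinnertonDyer-22820
--as helper`); it closes nothing and BSD is NOT proved by it.

The intrinsic rows of v16 (`cruxBody_of_twistBSDQuotient_intrinsic_spade`, per curve `C<label>.cruxBody_intrinsic_at`) keep THREE hypotheses on
the admissible prime `p`: good reduction, ordinarity, and «`ρ_{E,p^n}` onto for all `n`» — kernel-certified in the tree only at the prime of
record (`p = 5`, `7`). For a SEMISTABLE curve the third one is print at EVERY `p ≥ 11`: `E[p]` is irreducible (Mazur 1978 Thm. 4, from Mazur's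
torsion theorem — tree theorem `SkinnerUrban2014.hasIrreducibleModPGaloisRep_of_isSemistable_of_eleven_le`, CONDITIONAL on the named fact
`mazur_torsion`), hence `ρ̄_{E,p}` is onto (Serre 1972 §5.4 Prop. 21 i) / Edixhoven — PROVED in the tree,
`hasSurjectiveModNGaloisRep_of_hasIrreducibleModPGaloisRep_of_isSemistable`), hence `ρ_{E,p^n}` is onto for all `n` (Serre's lifting lemma,
PROVED: `serre_hasSurjectiveModNGaloisRep_pow_holds`).

* `tower_surjective_of_semistable_of_eleven_le` — `∀ n, ρ_{E,p^n}` onto, for `E` semistable globally minimal and `p ≥ 11`, granted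
  `mazur_torsion`.
* `cruxBody_of_twistBSDQuotient_intrinsic_semistable` — **THE INTRINSIC EVEN-RANK ROW FOR A SEMISTABLE CURVE AT EVERY `p ≥ 11`**: the only
  hypotheses left on `p < 1000` are «`p ∤ N_E`» (good reduction) and «`p ∤ a_p(E)`» (ordinarity) — plus Kodaira–Néron / ♠ (1), which the
  per-curve files prove for all `p ≥ 5` at once —; `K` ANY Heegner field (`d_K ∉ {−3,−4}`, `p ∤ d_K`); `T` ANY minimal model of `E^{(d_K)}`;
  datum «`r_an(E^{(d_K)}) = 1 ∧ ord_p(L'(T,1)/(Ω_T Reg_T)) ≤ k`», `k + 1 ≤ rank`. ♠ (2) is semistability itself.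

So, per SEMISTABLE rank-two curve of the table, the crux `KolyvaginDepthSupplyKN` at the curve is implied by: ONE ordinary prime `11 ≤ p < 1000`
of good reduction with `p ∤ d_K` for ONE Heegner field `K`, and the rank-one BSD-quotient datum of `E^{(d_K)}` at `p` — modulo print only.

CONDITIONAL on Mazur 1977 Thm. 8 (`mazur_torsion`), Stein–Wuthrich 2013 Thm. 1.1, W. Zhang 2014 L8.4 (1) / 9.1, Burungale–Castella–Skinner 2025
Cor. 1.3.1 and GZK, BY NAME; per `(W, p, K)`; nothing class-wide on the open stub (S♭); BSD is NOT proved by any of this.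

References: [Mazur1977] Thm. 8; [Mazur1978] Thm. 4 (p. 131); [Serre1972] §5.4 Prop. 21; [SerreAbelianLadic1968] IV-23 Lemma 3;
[SteinWuthrich2013] Thm. 1.1; [WZhang2014] L8.4 (1), Thm. 9.1; [BurungaleCastellaSkinner2025] Cor. 1.3.1; [Darmon2004] Thm. 3.22.
-/

set_option linter.dupNamespace false

noncomputable section

open scoped Classical NumberField

namespace Summit.BirchSwinnertonDyer.BirchSwinnertonDyer.Theorems.KolyvaginDepthDoor

open Literature.NumberTheory.EllipticCurves Literature.NumberTheory.EllipticCurves.ModularForms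
  WeierstrassCurve NumberField IsDedekindDomain
open Literature.NumberTheory.EllipticCurves.Rank1Residual
open Summit.BirchSwinnertonDyer.BirchSwinnertonDyer.Theorems

/-- **`ρ_{E,p^n}` is onto for every `n`, for `E/ℚ` semistable (globally minimal) and `p ≥ 11`, granted Mazur's torsion theorem by name**:
irreducibility by Mazur 1978 Thm. 4 (`SkinnerUrban2014.hasIrreducibleModPGaloisRep_of_isSemistable_of_eleven_le`), surjectivity mod `p` by
Serre 1972 Prop. 21 i) (`hasSurjectiveModNGaloisRep_of_hasIrreducibleModPGaloisRep_of_isSemistable`, proved), the tower by Serre's lifting lemma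
(`serre_hasSurjectiveModNGaloisRep_pow_holds`, proved). CONDITIONAL on `mazur_torsion`. [cite: Mazur1978, Thm. 4 (p. 131)]
[cite: Serre1972, §5.4 Prop. 21 i)] [cite: SerreAbelianLadic1968, Ch. IV §3.4 Lemma 3 (IV-23)] [cite: Mazur1977, Thm 8] -/
theorem tower_surjective_of_semistable_of_eleven_le
    (hMT : ∀ V : WeierstrassCurve ℚ, mazur_torsion V)
    (W : WeierstrassCurve ℚ) [W.IsElliptic] [W.IsGloballyMinimal] (hsst : W.IsSemistable ℤ)
    (p : ℕ) [hp : Fact p.Prime] (h11 : 11 ≤ p) :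
    ∀ n : ℕ, W.HasSurjectiveModNGaloisRep (p ^ n : ℕ) := by
  have hsemi : Semistable W := (semistable_iff_isSemistable_int W).mpr hsst
  have hsurj : W.HasSurjectiveModNGaloisRep p :=
    SkinnerUrban2014.surj_of_semistable_of_eleven_le W p hMT hsemi h11
  exact fun n ↦ serre_hasSurjectiveModNGaloisRep_pow_holds W p (by omega) hsurj n

/-- **THE INTRINSIC EVEN-RANK ROW FOR A SEMISTABLE CURVE AT EVERY `p ≥ 11` — the hypotheses on the prime reduced to good reduction and
ordinarity.** `W` globally minimal, semistable, non-CM, `2 ≤ rank_ℤ W(ℚ)`, `N_E ≤ 30 000`; `11 ≤ p < 1000` with good reduction, `p ∤ a_p`,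
Kodaira–Néron and ♠ (1) at `p` (per curve: all `p ≥ 5` at once); `K` ANY imaginary quadratic Heegner field with `d_K ∉ {−3,−4}`, `p ∤ d_K`; `T`
ANY globally minimal model of `E^{(d_K)}`. IF `ord_{s=1} L(E^{(d_K)}, s) = 1` and `ord_p(L'(T,1)/(Ω_T·Reg_T)) ≤ k`, `k + 1 ≤ rank W`, THEN the
clause of `KolyvaginDepthSupplyKN` holds at `W` VERBATIM: tower surjectivity from `tower_surjective_of_semistable_of_eleven_le`, ♠ (2) from
semistability, then `cruxBody_of_twistBSDQuotient_intrinsic_spade`. CONDITIONAL on `mazur_torsion`, Stein–Wuthrich Thm. 1.1, W. Zhang L8.4 (1) /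
9.1, BCS Cor. 1.3.1, GZK by name; per `(W, p, K)`; nothing class-wide; BSD is not proved by it. [cite: Mazur1978, Thm. 4 (p. 131)]
[cite: SteinWuthrich2013, Thm. 1.1 (p. 1758)] [cite: WZhang2014, Lemma 8.4 (1) (p. 236), Thm. 9.1 (p. 240)]
[cite: BurungaleCastellaSkinner2025, Cor. 1.3.1 (p. 4)] [cite: Darmon2004, Thm. 3.22] -/
theorem cruxBody_of_twistBSDQuotient_intrinsic_semistable
    (hMT : ∀ V : WeierstrassCurve ℚ, mazur_torsion V)
    (hSW : SteinWuthrich2013_sha_inf_torsionBy_eq_bot_of_two_le_rank)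
    (h84 : Literature.NumberTheory.EllipticCurves.WZhang2014_lemma84_exists_minimal_kolyvaginClass_one_selmerCard)
    (hBCS : BurungaleCastellaSkinner2025.cor131_padicValRat_bsd_rank_le_one)
    (hGZK : rank_eq_analyticRank_of_analyticRank_le_one)
    (W : WeierstrassCurve ℚ) [W.IsElliptic] [W.IsGloballyMinimal] (hsst : W.IsSemistable ℤ) (hcm : ¬ W.HasCM)
    (hr : 2 ≤ W.mordellWeilRank) (hN : W.conductorNorm ℤ ≤ 30000)
    (p : ℕ) [hp : Fact p.Prime] (h11 : 11 ≤ p) (hp1000 : p < 1000) (hgood : W.HasGoodReductionAtPrime p)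
    (hord : ¬ (p : ℤ) ∣ W.frobeniusTrace p)
    (hKN : ∀ v : HeightOneSpectrum (𝓞 ℚ), W.HasMultiplicativeReductionAt v →
      ¬ p ∣ W.ordMinimalDiscriminant v)
    (hS1 : ∀ (ℓ : ℕ) [Fact ℓ.Prime], W.HasMultiplicativeReductionAtPrime ℓ →
      ¬ p ∣ padicValInt ℓ W.minimalDiscriminantInt)
    (K : Type) [Field K] [NumberField K] (hK : IsImaginaryQuadratic K)
    (hD3 : NumberField.discr K ≠ -3) (hD4 : NumberField.discr K ≠ -4)
    (hpD : ¬ ((p : ℤ) ∣ NumberField.discr K))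
    [iNZ : NeZero (W.conductorNorm ℤ)] (hH : SatisfiesHeegnerHypothesis (W.conductorNorm ℤ) K)
    (T : WeierstrassCurve ℚ) [T.IsElliptic] [T.IsGloballyMinimal] (C : WeierstrassCurve.VariableChange ℚ)
    (hC : C • T = W.quadraticTwist (NumberField.discr K : ℚ))
    (hTr : (W.quadraticTwist (NumberField.discr K : ℚ)).analyticRank = 1)
    (k : ℕ) (hk : k + 1 ≤ W.mordellWeilRank)
    (hval : ∀ q : ℚ, T.leadingLCoeff / ((T.realPeriodRat * T.regulator : ℝ) : ℂ) = (q : ℂ) → padicValRat p q ≤ k) :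
    ∃ (p : ℕ) (hp : Fact p.Prime), 5 ≤ p ∧ W.HasGoodReductionAtPrime p ∧
      ¬ (p : ℤ) ∣ W.frobeniusTrace p ∧ (∀ n : ℕ, W.HasSurjectiveModNGaloisRep (p ^ n : ℕ)) ∧
      (∀ v : HeightOneSpectrum (𝓞 ℚ), W.HasMultiplicativeReductionAt v →
        ¬ p ∣ W.ordMinimalDiscriminant v) ∧
      ∃ (K : Type) (_ : Field K) (_ : NumberField K), IsImaginaryQuadratic K ∧
        NumberField.discr K ≠ -3 ∧ NumberField.discr K ≠ -4 ∧
        ∃ (_ : NeZero (W.conductorNorm ℤ)), SatisfiesHeegnerHypothesis (W.conductorNorm ℤ) K ∧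
        ∃ (Dt : ModularParametrizationData W (W.conductorNorm ℤ)) (β : ℤ) (ι : K →+* ℂ) (n₁ : ℕ)
          (d : KolyvaginHeegnerData Dt β ι n₁), Squarefree n₁ ∧
          (∀ q ∈ n₁.primeFactors, Zhang2014.IsKolyvaginPrime (W.conductorNorm ℤ) W K p q) ∧
          d.kolyvaginClass hp.out 1 ≠ 0 ∧
          (n₁.primeFactors.card + 1 ≤ W.mordellWeilRank ∨
            (n₁.primeFactors.card ≤ W.mordellWeilRank ∧
              n₁.primeFactors.card + 1 ≤ (W.quadraticTwist (NumberField.discr K : ℚ)).mordellWeilRank)) := by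
  have htower := tower_surjective_of_semistable_of_eleven_le hMT W hsst p h11
  have hS2 : ¬ Squarefree (W.conductorNorm ℤ) →
      (∃ (ℓ : ℕ) (_ : Fact ℓ.Prime), W.HasMultiplicativeReductionAtPrime ℓ ∧
          ¬ p ∣ padicValInt ℓ W.minimalDiscriminantInt) ∧
        ∃ (ℓ₁ ℓ₂ : ℕ) (_ : Fact ℓ₁.Prime) (_ : Fact ℓ₂.Prime), ℓ₁ ≠ ℓ₂ ∧
          W.HasMultiplicativeReductionAtPrime ℓ₁ ∧ W.HasMultiplicativeReductionAtPrime ℓ₂ :=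
    fun hns ↦ absurd (W.isSemistable_iff_squarefree_conductorNorm.mp hsst) hns
  exact cruxBody_of_twistBSDQuotient_intrinsic_spade hSW h84 hBCS hGZK W hcm hr hN p (by omega) hp1000 hgood hord htower hKN hS1 hS2
    K hK hD3 hD4 hpD hH T C hC hTr k hk hval

end Summit.BirchSwinnertonDyer.BirchSwinnertonDyer.Theorems.KolyvaginDepthDoor

end
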